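import Mathlib
import HarnessLib
import Summits.HubbardSuperconductivity.HubbardSuperconductivity.Theorems.KLProgrammeC4aLevelChartJacobian

/-!
# Route `KLProgramme` — crux C4a: the IMAGE of the co-moving chart is the momentum TUBE `{|e_K| < r}` of the open square, and the
# tube integral in chart coordinates ((L2): momentum plane ↔ chart, completed)

Cell `gate-hubbard-kl`, lane hubbard-kl-c4a-1 (g2); helper for the engine-flow child `KLRegimeEngineV17F2` (stmt-HubbardSuperconductivity-20437),
stub (C) `stub_twoLeg_curvature` (memo HOME/hubbard-kl-c4a-1/C4A-PLAN.md §9 (L2)).  `…C4aLevelChartJacobian` proved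
`∫_{levelChart '' box} g = ∫_{box} (u·∂_ρu) • g ∘ levelChart` for the box `(−r, r) × (−π, π]`; this file identifies the image:

* `levelChart_image` (§2): `levelChart μ K '' ((−r,r) ×ˢ (−π,π]) = {q ∈ ℝ² : |q₁| < π, |q₂| < π, |e_K(q)| < r}` — the scale tube of the
  frame band inside the open Brillouin square.  `⊆`: the chart point lies in the open square (`abs_perturbedFermiRadius_smul_dir_lt`) on the
  level-`ρ` curve (`frameLevel_levelPoint`).  `⊇`: write `q = t·(cos ϑ, sin ϑ)` (`t = ‖q‖₂ > 0`, `ϑ = arg q ∈ (−π, π]`; `q ≠ 0` because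
  `e_K(0) < −r`); then `t` is a band Fermi radius of the shifted level on the ray `ϑ`, hence — ray-wise UNIQUENESS under the radial
  Lipschitz bound `2A < Dt_min` (`eq_perturbedFermiRadius_of_isBandFermiRadius`) — `t = u_K(μ + e_K(q); ϑ)` and `q = levelChart μ K (e_K(q), ϑ)`;
* `setIntegral_tube_eq_chart` (§3): for every `g`,
  `∫_{q ∈ tube} g q = ∫_{(ρ,ϑ) ∈ (−r,r) ×ˢ (−π,π]} (u·∂_ρu)(ρ,ϑ) • g (levelChart μ K (ρ, ϑ))`;
* `setIntegral_box_shift_angle` (§3): for an integrand `2π`-periodic in the angle the box `(−r,r) × (−π,π]` may be replaced by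
  `(−r,r) × (0, 2π]` (the angular window of `…C4aTadpoleJets`).

Pure calculus on the tree's objects; nothing is asserted about the Hubbard model.  References: BGM 2006 §2.4 Lemma 2.1 (2.40)
[cite: BenfattoGiulianiMastropietro2006]; FST II CPAM 51 (1998) 1133 (H2)(2).
-/

noncomputable section

namespace Summit.HubbardSuperconductivity.HubbardSuperconductivity.Theorems.C4a

set_option linter.dupNamespace false -- summit = problem name (single-conjunct summit), D-0017

open Real Set MeasureTheory Filter
open scoped Topology
open Literature.MathematicalPhysics.QuantumLattice Literature.MathematicalPhysics.QuantumLattice.BandSectorCounting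
open Summit.HubbardSuperconductivity.HubbardSuperconductivity.Theorems.DispersionFlow
open Summit.HubbardSuperconductivity.HubbardSuperconductivity.Theorems.KLRegimeSplit
open Summit.HubbardSuperconductivity.HubbardSuperconductivity.Theorems.PerturbedFermiCurve

/-! ## §1 Plane bookkeeping -/

/-- The plane coordinates of the chart point assemble to the lattice-coordinate Fermi point: `![q₁, q₂] = klFermiPoint (μ+ρ) K ϑ`. -/
theorem vec_levelChart (μ : ℝ) (K : TrigPolyC4v) (p : ℝ × ℝ) :
    ![(levelChart μ K p).1, (levelChart μ K p).2] = klFermiPoint (μ + p.1) K p.2 := by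
  funext i
  fin_cases i
  · simp [levelChart_apply, klFermiPoint, dir]
  · simp [levelChart_apply, klFermiPoint, dir]

/-- Hence `toLp ![q₁, q₂] = levelPoint μ K ρ ϑ` for `q = levelChart μ K (ρ, ϑ)`. -/
theorem toLp_vec_levelChart (μ : ℝ) (K : TrigPolyC4v) (p : ℝ × ℝ) :
    WithLp.toLp 2 ![(levelChart μ K p).1, (levelChart μ K p).2] = levelPoint μ K p.1 p.2 := by
  rw [vec_levelChart]; rfl

/-- The band at the origin: `e_K(0) = −4 − μ − K(0)` (the bottom of the free band, shifted). -/
theorem frameLevel_toLp_zero (μ : ℝ) (K : TrigPolyC4v) :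
    frameLevel μ K (WithLp.toLp 2 (0 : Fin 2 → ℝ)) = -4 + frameShift K (WithLp.toLp 2 (0 : Fin 2 → ℝ)) - μ := by
  rw [frameLevel_toLp]
  simp [sqDispersion]
  ring

/-- Polar decomposition of a nonzero plane point through `Complex.arg`: `q = ‖q‖₂·(cos ϑ, sin ϑ)`, `ϑ = arg(q₁ + i q₂) ∈ (−π, π]`. -/
theorem eq_norm_mul_cos_sin_arg (q : ℝ × ℝ) (hq : (⟨q.1, q.2⟩ : ℂ) ≠ 0) :
    q.1 = ‖(⟨q.1, q.2⟩ : ℂ)‖ * Real.cos (Complex.arg ⟨q.1, q.2⟩) ∧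
      q.2 = ‖(⟨q.1, q.2⟩ : ℂ)‖ * Real.sin (Complex.arg ⟨q.1, q.2⟩) := by
  have hn : ‖(⟨q.1, q.2⟩ : ℂ)‖ ≠ 0 := norm_ne_zero_iff.2 hq
  constructor
  · rw [Complex.cos_arg hq]; field_simp
  · rw [Complex.sin_arg]; field_simp

/-! ## §2 The image of the chart box is the tube of the open square -/

section Image

variable {a b : ℝ} (B : BandBounds a b) {K : TrigPolyC4v} {A : ℝ}
  (hA : ∀ p : Momentum, ∀ j ≤ 2, ‖iteratedFDeriv ℝ j (frameShift K) p‖ ≤ A) (hADt : 2 * A < B.Dtmin)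
  {μ r : ℝ} (hlo : a ≤ μ - r - A) (hhi : μ + r + A ≤ b)
include B hA hADt hlo hhi

/-- **The image of the chart box is the momentum tube of the open square**:
`levelChart μ K '' ((−r,r) ×ˢ (−π,π]) = {q : |q₁| < π ∧ |q₂| < π ∧ |e_K(q)| < r}`. -/
theorem levelChart_image :
    levelChart μ K '' (Ioo (-r) r ×ˢ Ioc (-π) π) =
      {q : ℝ × ℝ | |q.1| < π ∧ |q.2| < π ∧ |frameLevel μ K (WithLp.toLp 2 ![q.1, q.2])| < r} := by
  -- frame data in the form the radius lemmas want
  have hδc : Continuous (fun k : Fin 2 → ℝ => -K.eval k) := by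
    rw [← frameShift_toLp_eq_neg_eval]; exact continuous_frameShift_toLp K
  have hδ : ∀ k : Fin 2 → ℝ, (∀ i, |k i| ≤ π) → |(fun p : Fin 2 → ℝ => -K.eval p) k| ≤ A := fun k _ => by
    simpa [frameShift_toLp] using abs_frameShift_toLp_le hA k
  have hd : ∀ k : Fin 2 → ℝ, (∀ i, |k i| ≤ π) → DifferentiableAt ℝ (fun p : Fin 2 → ℝ => -K.eval p) k := fun k _ => by
    rw [← frameShift_toLp_eq_neg_eval]; exact (differentiable_frameShift_toLp K) k
  have hκ : ∀ k : Fin 2 → ℝ, (∀ i, |k i| ≤ π) → ‖fderiv ℝ (fun p : Fin 2 → ℝ => -K.eval p) k‖ ≤ 2 * A := fun k _ => by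
    rw [← frameShift_toLp_eq_neg_eval]; exact norm_fderiv_frameShift_toLp_le hA k
  ext q
  constructor
  · -- ⊆ : chart points lie in the open square, on the level-ρ curve
    rintro ⟨p, hp, rfl⟩
    have hp1 : p.1 ∈ Ioo (-r) r := (mem_prod.1 hp).1
    have hlo' : a ≤ μ + p.1 - A := by linarith [hp1.1]
    have hhi' : μ + p.1 + A ≤ b := by linarith [hp1.2]
    have hsq := abs_perturbedFermiRadius_smul_dir_lt B hδc hδ (μ := μ + p.1) hlo' hhi' p.2
    refine ⟨?_, ?_, ?_⟩
    · have h0 := hsq 0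
      simpa [levelChart_apply, dir] using h0
    · have h1 := hsq 1
      simpa [levelChart_apply, dir] using h1
    · rw [toLp_vec_levelChart, frameLevel_levelPoint B hA hlo' hhi']
      exact abs_lt.2 ⟨hp1.1, hp1.2⟩
  · -- ⊇ : polar decomposition + ray-wise uniqueness of the radius
    rintro ⟨h1, h2, h3⟩
    set k : Fin 2 → ℝ := ![q.1, q.2] with hk
    set ρ : ℝ := frameLevel μ K (WithLp.toLp 2 k) with hρ
    have hρr : ρ ∈ Ioo (-r) r := ⟨(abs_lt.1 h3).1, (abs_lt.1 h3).2⟩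
    have hlo' : a ≤ μ + ρ - A := by linarith [hρr.1]
    have hhi' : μ + ρ + A ≤ b := by linarith [hρr.2]
    -- q ≠ 0: the origin is below the tube
    set z : ℂ := ⟨q.1, q.2⟩ with hz
    have hz0 : z ≠ 0 := by
      intro h0
      have hq1 : q.1 = 0 := by simpa [hz] using congrArg Complex.re h0
      have hq2 : q.2 = 0 := by simpa [hz] using congrArg Complex.im h0
      have hk0 : k = 0 := by
        funext i; fin_cases i <;> simp [hk, hq1, hq2]
      have hval : ρ = -4 + frameShift K (WithLp.toLp 2 (0 : Fin 2 → ℝ)) - μ := by rw [hρ, hk0, frameLevel_toLp_zero]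
      have hfs : |frameShift K (WithLp.toLp 2 (0 : Fin 2 → ℝ))| ≤ A := abs_frameShift_toLp_le hA 0
      have := (abs_le.1 hfs).2
      have ha := B.ha
      linarith [hρr.1]
    -- polar decomposition
    set t : ℝ := ‖z‖ with ht
    set ϑ : ℝ := Complex.arg z with hϑ
    have htpos : 0 < t := norm_pos_iff.2 hz0
    obtain ⟨hq1, hq2⟩ := eq_norm_mul_cos_sin_arg q hz0
    have hkt : k = t • dir ϑ := by
      funext i; fin_cases i
      · simp [hk, dir, ht, hϑ, hz]
      · simp [hk, dir, ht, hϑ, hz]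
    have hki : ∀ i, |k i| ≤ π := by
      intro i; fin_cases i
      · simpa [hk] using h1.le
      · simpa [hk] using h2.le
    -- t is a band Fermi radius of the shifted level on the ray ϑ
    have hsq : t * ‖dir ϑ‖ ≤ π := by
      have hnorm : ‖k‖ ≤ π := (pi_norm_le_iff_of_nonneg pi_pos.le).2 fun i => by
        rw [Real.norm_eq_abs]; exact hki i
      rw [hkt, norm_smul, Real.norm_eq_abs, abs_of_pos htpos] at hnorm
      exact hnorm
    have hroot : IsBandFermiRadius (μ + ρ - (fun p : Fin 2 → ℝ => -K.eval p) (t • dir ϑ)) ϑ t := by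
      refine (isBandFermiRadius_shifted_iff (fun p : Fin 2 → ℝ => -K.eval p) (μ + ρ) ϑ t).2 ⟨⟨htpos.le, hsq⟩, ?_⟩
      rw [← hkt]
      have hlev : ρ = sqDispersion k + frameShift K (WithLp.toLp 2 k) - μ := by rw [hρ, frameLevel_toLp]
      rw [frameShift_toLp] at hlev
      show sqDispersion k + -K.eval k = μ + ρ
      linarith
    have hL := radialLipschitz_of_fderiv_le hd hκ ϑ
    have htu : t = perturbedFermiRadius (fun p : Fin 2 → ℝ => -K.eval p) (μ + ρ) ϑ :=
      eq_perturbedFermiRadius_of_isBandFermiRadius B hδc hδ hlo' hhi' hL hADt hroot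
    -- assemble
    refine ⟨(ρ, ϑ), mk_mem_prod hρr (by simpa [hϑ] using Complex.arg_mem_Ioc z), ?_⟩
    rw [levelChart_apply]
    simp only
    rw [← htu]
    exact Prod.ext hq1.symm hq2.symm

end Image

/-! ## §3 The tube integral in chart coordinates; the angular window -/

section TubeIntegral

variable {a b : ℝ} (B : BandBounds a b) {K : TrigPolyC4v} {A : ℝ}
  (hA : ∀ p : Momentum, ∀ j ≤ 2, ‖iteratedFDeriv ℝ j (frameShift K) p‖ ≤ A) (hADt : 2 * A < B.Dtmin)
  {μ r : ℝ} (hlo : a < μ - r - A) (hhi : μ + r + A < b)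
include B hA hADt hlo hhi

/-- **The tube integral in chart coordinates**: for every `g : ℝ × ℝ → E`,
`∫_{|q₁|,|q₂| < π, |e_K(q)| < r} g = ∫_{(ρ,ϑ) ∈ (−r,r) ×ˢ (−π,π]} (u·∂_ρu)(ρ,ϑ) • g (levelChart μ K (ρ,ϑ))`. -/
theorem setIntegral_tube_eq_chart {E : Type*} [NormedAddCommGroup E] [NormedSpace ℝ E] (g : ℝ × ℝ → E) :
    ∫ q in {q : ℝ × ℝ | |q.1| < π ∧ |q.2| < π ∧ |frameLevel μ K (WithLp.toLp 2 ![q.1, q.2])| < r}, g q =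
      ∫ p in Ioo (-r) r ×ˢ Ioc (-π) π,
        (perturbedFermiRadius (fun k : Fin 2 → ℝ => -K.eval k) (μ + p.1) p.2 *
          deriv (fun m : ℝ => perturbedFermiRadius (fun k : Fin 2 → ℝ => -K.eval k) m p.2) (μ + p.1)) • g (levelChart μ K p) := by
  rw [← levelChart_image B hA hADt hlo.le hhi.le, integral_image_levelChart B hA hADt hlo hhi]

end TubeIntegral

/-- **Shifting the angular window**: for `h : ℝ × ℝ → E` integrable on both boxes and `2π`-periodic in the angle,
`∫_{(−r,r) × (−π,π]} h = ∫_{(−r,r) × (0,2π]}` (Fubini + `Function.Periodic.intervalIntegral_add_eq`). -/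
theorem setIntegral_box_shift_angle {E : Type*} [NormedAddCommGroup E] [NormedSpace ℝ E] {h : ℝ × ℝ → E} {r : ℝ}
    (hper : ∀ ρ, Function.Periodic (fun ϑ => h (ρ, ϑ)) (2 * π))
    (hint₁ : IntegrableOn h (Ioo (-r) r ×ˢ Ioc (-π) π)) (hint₂ : IntegrableOn h (Ioo (-r) r ×ˢ Ioc 0 (2 * π))) :
    ∫ p in Ioo (-r) r ×ˢ Ioc (-π) π, h p = ∫ p in Ioo (-r) r ×ˢ Ioc 0 (2 * π), h p := by
  rw [Measure.volume_eq_prod] at hint₁ hint₂ ⊢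
  rw [setIntegral_prod _ hint₁, setIntegral_prod _ hint₂]
  refine setIntegral_congr_fun measurableSet_Ioo fun ρ _ => ?_
  have e1 : ∫ ϑ in Ioc (-π) π, h (ρ, ϑ) = ∫ ϑ in (-π)..(-π + 2 * π), h (ρ, ϑ) := by
    rw [intervalIntegral.integral_of_le (by linarith [pi_pos]), show -π + 2 * π = π by ring]
  have e2 : ∫ ϑ in Ioc 0 (2 * π), h (ρ, ϑ) = ∫ ϑ in (0 : ℝ)..(0 + 2 * π), h (ρ, ϑ) := by
    rw [intervalIntegral.integral_of_le (by linarith [pi_pos]), zero_add]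
  rw [e1, e2]
  exact (hper ρ).intervalIntegral_add_eq (-π) 0

end Summit.HubbardSuperconductivity.HubbardSuperconductivity.Theorems.C4a
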